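import Summits.HodgeConjecture.HodgeConjecture.Theorems.HLiu418E2DiscBoost
import Summits.HodgeConjecture.HodgeConjecture.Theorems.HLiu418E2Density
import Summits.HodgeConjecture.HodgeConjecture.Theorems.HLiu418E2Bootstrap
import HarnessLib

/-!
# Crux `HLiu418`, K-lane E₂ — S2⁺₂ by the disc identity, I: the cotangent LAW on `L²` classes (rotations act by the character, boosts
# absorb the slice), translates of cone-holomorphic forms, and unitarity bookkeeping

Cell `hodgecm-mathlib`, FLOOR 0, programme P5 (`F0_AlbCm`); crux item `stmt-HodgeConjecture-24832`; seat F0P5-p02 (g2),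
`--supports stmt-HodgeConjecture-24832` (helper).  THEOREMS ONLY — no definition, no instance, no notation, no `sorry`.

For a rank-2 unitary datum `U(J)`, `J ∈ M₂(E)`, a complex place `w₁`, a cone frame `𝔣` and a cone-HOLOMORPHIC cotangent form
`f ∈ holCotForms₂ … 𝔣` (★ `UnitaryCurveForms`), clause (H) of the carrier (the `w₁`-slice through every adelic point is the restriction of an
`IsConeHol` function) yields, for `u, κ ∈ U = U(σ_{w₁}J)(ℂ)` with `κ v₀ = q v₀`, `κ t₀ = a t₀ + d v₀`:
* §1 `apply_mul_adelicSingle_mul` — `f(x · ι(uκ)) = (a/q) f(x · ι u)` (`ι = adelicSingle w₁`), and on classes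
  `rightRegular_adelicSingle_mul` — `R(ι(uκ))[f] = (a/q) • R(ι u)[f]` (★ `SpectrumJunction.toLp_toQuotFun_mul_right`; translates of `f` are
  continuous and left-invariant, hence square-integrable on the COMPACT quotient); in particular for the rotations `k_w` of ★
  `E2DiscBoost.exists_rotation`: `R(ι k_w)[f] = w • [f]`, `R(ι k_w⁻¹)[f] = w⁻¹ • [f]`;
* §2 `apply_slice_eq` — for a boost `u_z` of ★ `E2DiscBoost.exists_boost` and the slice `s(z) = 1 + zN`, the cone-holomorphic extension `Φ_x` of the
  slice of `f` at `x` satisfies `Φ_x(s(z)) = ν⁻² f(x · ι u_z)` (the boost absorbs the slice, ★ `inv_boost_mulVec_slice`);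
* §3 `inner_rightRegular_right` — `⟪x, R(g) y⟫ = ⟪R(g⁻¹) x, y⟫` (unitarity, ★ `E2Bootstrap.inner_rightRegular_rightRegular`).
Consumed by ★-candidate `Theorems/HLiu418E2ArchOrthHol` (the head `archOrth₂_of_frame`).
HONEST LABEL: HC_CM is proved only modulo the 7 printed citations until rung 0 closes; this file discharges none of them.

## References
* [Borel1997] A. Borel, *Automorphic forms on SL₂(ℝ)* (1997), §5.13–§5.14.  [BorelJacquet1979] Corvallis PSPM 33.1, §4.2, §4.6.
* [BergeronMillsonMoeglin2016Balls] Acta Math. 216 (2016), Part 2 §1.3.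
-/

set_option autoImplicit false
-- the mandated namespace has the single-problem summit's repeated segment (`HodgeConjecture.HodgeConjecture`)
set_option linter.dupNamespace false

noncomputable section

open Matrix MeasureTheory NumberField NumberField.InfinitePlace
open scoped Matrix ComplexConjugate ComplexOrder InnerProductSpace ENNReal
open Literature.NumberTheory.Automorphic Literature.NumberTheory.Automorphic.UnitaryGroup
open Literature.NumberTheory.Automorphic.UnitaryGroup.CotangentForms (toQuotFun)
open Literature.NumberTheory.Automorphic.UnitaryCurveForms
open Literature.AlgebraicGeometry.ShimuraVarieties Literature.AlgebraicGeometry.ShimuraVarieties.UnitaryCurveCone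
open Summit.HodgeConjecture.HodgeConjecture.Cruxes.H413.SpectrumJunction
open Summit.HodgeConjecture.HodgeConjecture.Cruxes.HLiu418.E2Density
open Summit.HodgeConjecture.HodgeConjecture.Cruxes.HLiu418.E2Bootstrap
open Summit.HodgeConjecture.HodgeConjecture.Cruxes.HLiu418.E2DiscSlice
open Summit.HodgeConjecture.HodgeConjecture.Cruxes.HLiu418.E2DiscBoost

namespace Summit.HodgeConjecture.HodgeConjecture.Cruxes.HLiu418.E2ArchOrthHolPrep

variable {F E : Type} [Field F] [NumberField F] [Field E] [NumberField E] [Algebra F E]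
  {c : E ≃ₐ[F] E} {J : Matrix (Fin 2) (Fin 2) E}
  {hc : c ≠ 1} {hfix : ∀ w : InfinitePlace E, c • w = w} {w₁ : {w : InfinitePlace E // IsComplex w}} {𝔣 : ConeFrame E J w₁}

/-! ## §1 The cotangent law for translates, pointwise and on `L²` classes -/

/-- **The cotangent law for translates (pointwise).**  For `f ∈ holCotForms₂ … 𝔣` and `u, κ ∈ U` with `κ v₀ = q v₀` (`q ≠ 0`),
`κ t₀ = a t₀ + d v₀`: `f (x · ι(uκ)) = (a q⁻¹) f (x · ι u)` for every adelic `x` (clause (H) at `x`: the slice is the restriction of a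
cone-law function, applied at `g = u`, `b = κ`). [cite: Borel1997, §5.13–§5.14] -/
theorem apply_mul_adelicSingle_mul {f : (adelicGroupData F E c 2 J).Adelic → ℂ} (hf : f ∈ holCotForms₂ F E c J hc hfix w₁ 𝔣)
    (u κ : archLocal E 2 J w₁) {q a d : ℂ} (hq : q ≠ 0)
    (hκv : ((κ : GL (Fin 2) ℂ) : Matrix (Fin 2) (Fin 2) ℂ) *ᵥ 𝔣.v₀ = q • 𝔣.v₀)
    (hκt : ((κ : GL (Fin 2) ℂ) : Matrix (Fin 2) (Fin 2) ℂ) *ᵥ 𝔣.t₀ = a • 𝔣.t₀ + d • 𝔣.v₀) (x : (adelicGroupData F E c 2 J).Adelic) :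
    f (x * adelicSingle F E c 2 J hc hfix w₁ (u * κ)) = (a * q⁻¹) * f (x * adelicSingle F E c 2 J hc hfix w₁ u) := by
  obtain ⟨Φ, hΦ, hΦf⟩ := ((mem_holCotForms₂_iff F E c J hc hfix w₁ 𝔣 f).1 hf).2.2.2 x
  rw [← hΦf, ← hΦf]
  have hU := isUnit_and_mulVec_mem_negCone 𝔣 u
  rw [show (((u * κ : archLocal E 2 J w₁) : GL (Fin 2) ℂ) : Matrix (Fin 2) (Fin 2) ℂ) =
      ((u : GL (Fin 2) ℂ) : Matrix (Fin 2) (Fin 2) ℂ) * ((κ : GL (Fin 2) ℂ) : Matrix (Fin 2) (Fin 2) ℂ) by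
    rw [Subgroup.coe_mul, Units.val_mul]]
  exact hΦ.2 _ _ a q d hU.1 hU.2 hq hκv hκt

section Classes

variable {μ : Measure (adelicGroupData F E c 2 J).automorphicQuotient} [(adelicGroupData F E c 2 J).IsAutomorphicMeasure μ]
  [CompactSpace (adelicGroupData F E c 2 J).automorphicQuotient]

/-- Translates `x ↦ f (x h)` of a cone-holomorphic cotangent form are square-integrable on the (compact) automorphic quotient.
[cite: BorelJacquet1979, §4.2 and §4.6] -/
theorem memLp_toQuotFun_mul_right {f : (adelicGroupData F E c 2 J).Adelic → ℂ} (hf : f ∈ holCotForms₂ F E c J hc hfix w₁ 𝔣)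
    (h : (adelicGroupData F E c 2 J).Adelic) :
    MemLp (toQuotFun (adelicGroupData F E c 2 J) fun x => f (x * h)) 2 μ :=
  memLp_toQuotFun (leftInvariant_mul_right (leftInvariant_of_mem_holCotForms₂ hf) h)
    ((continuous_of_mem_holCotForms₂ F E c J hc hfix w₁ 𝔣 hf).comp (continuous_id.mul continuous_const)) 2

/-- A cone-holomorphic cotangent form itself is square-integrable on the (compact) automorphic quotient. [cite: BorelJacquet1979, §4.6] -/
theorem memLp_toQuotFun_self {f : (adelicGroupData F E c 2 J).Adelic → ℂ} (hf : f ∈ holCotForms₂ F E c J hc hfix w₁ 𝔣) :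
    MemLp (toQuotFun (adelicGroupData F E c 2 J) f) 2 μ :=
  memLp_toQuotFun (leftInvariant_of_mem_holCotForms₂ hf) (continuous_of_mem_holCotForms₂ F E c J hc hfix w₁ 𝔣 hf) 2

/-- **The regular representation on the class of a cone form is the class of the translate**: `R(h)[f] = [x ↦ f (x h)]`
(★ `toLp_toQuotFun_mul_right`). [cite: BorelJacquet1979, §4.6] -/
theorem rightRegular_toLp_eq {f : (adelicGroupData F E c 2 J).Adelic → ℂ} (hf : f ∈ holCotForms₂ F E c J hc hfix w₁ 𝔣)
    (hfm : MemLp (toQuotFun (adelicGroupData F E c 2 J) f) 2 μ) (h : (adelicGroupData F E c 2 J).Adelic) :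
    (adelicGroupData F E c 2 J).rightRegular μ h (hfm.toLp (toQuotFun (adelicGroupData F E c 2 J) f)) =
      (memLp_toQuotFun_mul_right (μ := μ) hf h).toLp (toQuotFun (adelicGroupData F E c 2 J) fun x => f (x * h)) :=
  (toLp_toQuotFun_mul_right (leftInvariant_of_mem_holCotForms₂ hf) h hfm (memLp_toQuotFun_mul_right hf h)).symm

/-- **The cotangent law on classes**: `R(ι(uκ))[f] = (a q⁻¹) • R(ι u)[f]` for `κ ∈ U ∩ Stab(ℂ v₀)` with frame coordinates `(q, a, d)`.
[cite: Borel1997, §5.13–§5.14] [cite: BorelJacquet1979, §4.6] -/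
theorem rightRegular_adelicSingle_mul {f : (adelicGroupData F E c 2 J).Adelic → ℂ} (hf : f ∈ holCotForms₂ F E c J hc hfix w₁ 𝔣)
    (hfm : MemLp (toQuotFun (adelicGroupData F E c 2 J) f) 2 μ) (u κ : archLocal E 2 J w₁) {q a d : ℂ} (hq : q ≠ 0)
    (hκv : ((κ : GL (Fin 2) ℂ) : Matrix (Fin 2) (Fin 2) ℂ) *ᵥ 𝔣.v₀ = q • 𝔣.v₀)
    (hκt : ((κ : GL (Fin 2) ℂ) : Matrix (Fin 2) (Fin 2) ℂ) *ᵥ 𝔣.t₀ = a • 𝔣.t₀ + d • 𝔣.v₀) :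
    (adelicGroupData F E c 2 J).rightRegular μ (adelicSingle F E c 2 J hc hfix w₁ (u * κ))
        (hfm.toLp (toQuotFun (adelicGroupData F E c 2 J) f)) =
      (a * q⁻¹) • (adelicGroupData F E c 2 J).rightRegular μ (adelicSingle F E c 2 J hc hfix w₁ u)
        (hfm.toLp (toQuotFun (adelicGroupData F E c 2 J) f)) := by
  rw [rightRegular_toLp_eq hf hfm, rightRegular_toLp_eq hf hfm, ← MemLp.toLp_const_smul]
  exact MemLp.toLp_congr _ _ (Filter.EventuallyEq.of_eq (funext fun y => by
    simp only [toQuotFun, Pi.smul_apply, smul_eq_mul, apply_mul_adelicSingle_mul hf u κ hq hκv hκt]))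

/-- **Rotations act by the cotangent character**: for `k_w ∈ U` with `k_w t₀ = w t₀`, `k_w v₀ = v₀`: `R(ι k_w)[f] = w • [f]`.
[cite: Borel1997, §5.13–§5.14] -/
theorem rightRegular_rotation {f : (adelicGroupData F E c 2 J).Adelic → ℂ} (hf : f ∈ holCotForms₂ F E c J hc hfix w₁ 𝔣)
    (hfm : MemLp (toQuotFun (adelicGroupData F E c 2 J) f) 2 μ) {k : archLocal E 2 J w₁} {w : ℂ}
    (hkt : ((k : GL (Fin 2) ℂ) : Matrix (Fin 2) (Fin 2) ℂ) *ᵥ 𝔣.t₀ = w • 𝔣.t₀)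
    (hkv : ((k : GL (Fin 2) ℂ) : Matrix (Fin 2) (Fin 2) ℂ) *ᵥ 𝔣.v₀ = 𝔣.v₀) :
    (adelicGroupData F E c 2 J).rightRegular μ (adelicSingle F E c 2 J hc hfix w₁ k) (hfm.toLp (toQuotFun (adelicGroupData F E c 2 J) f)) =
      w • hfm.toLp (toQuotFun (adelicGroupData F E c 2 J) f) := by
  have h := rightRegular_adelicSingle_mul (μ := μ) hf hfm 1 k (q := 1) (a := w) (d := 0) one_ne_zero (by rw [hkv, one_smul])
    (by rw [hkt, zero_smul, add_zero])
  rw [one_mul, map_one, map_one, inv_one, mul_one] at h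
  rw [h, one_apply_eq_self]

/-- The inverse rotation: `R(ι k_w⁻¹)[f] = w⁻¹ • [f]` (`|w| = 1`). [cite: Borel1997, §5.13–§5.14] -/
theorem rightRegular_rotation_inv {f : (adelicGroupData F E c 2 J).Adelic → ℂ} (hf : f ∈ holCotForms₂ F E c J hc hfix w₁ 𝔣)
    (hfm : MemLp (toQuotFun (adelicGroupData F E c 2 J) f) 2 μ) {k : archLocal E 2 J w₁} {w : ℂ} (hw : ‖w‖ = 1)
    (hkt : ((k : GL (Fin 2) ℂ) : Matrix (Fin 2) (Fin 2) ℂ) *ᵥ 𝔣.t₀ = w • 𝔣.t₀)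
    (hkv : ((k : GL (Fin 2) ℂ) : Matrix (Fin 2) (Fin 2) ℂ) *ᵥ 𝔣.v₀ = 𝔣.v₀) :
    (adelicGroupData F E c 2 J).rightRegular μ (adelicSingle F E c 2 J hc hfix w₁ k⁻¹) (hfm.toLp (toQuotFun (adelicGroupData F E c 2 J) f)) =
      w⁻¹ • hfm.toLp (toQuotFun (adelicGroupData F E c 2 J) f) := by
  have hw0 : w ≠ 0 := fun h0 => by rw [h0, norm_zero] at hw; exact zero_ne_one hw
  -- `k⁻¹ t₀ = w⁻¹ t₀`, `k⁻¹ v₀ = v₀`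
  have hmul : (((k⁻¹ : archLocal E 2 J w₁) : GL (Fin 2) ℂ) : Matrix (Fin 2) (Fin 2) ℂ) * ((k : GL (Fin 2) ℂ) : Matrix (Fin 2) (Fin 2) ℂ) = 1 := by
    rw [Subgroup.coe_inv, ← Units.val_mul, inv_mul_cancel, Units.val_one]
  have hk't : (((k⁻¹ : archLocal E 2 J w₁) : GL (Fin 2) ℂ) : Matrix (Fin 2) (Fin 2) ℂ) *ᵥ 𝔣.t₀ = w⁻¹ • 𝔣.t₀ := by
    have h1 : (((k⁻¹ : archLocal E 2 J w₁) : GL (Fin 2) ℂ) : Matrix (Fin 2) (Fin 2) ℂ) *ᵥ (w • 𝔣.t₀) = 𝔣.t₀ := by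
      rw [← hkt, mulVec_mulVec, hmul, one_mulVec]
    rw [mulVec_smul] at h1
    calc (((k⁻¹ : archLocal E 2 J w₁) : GL (Fin 2) ℂ) : Matrix (Fin 2) (Fin 2) ℂ) *ᵥ 𝔣.t₀
        = w⁻¹ • (w • ((((k⁻¹ : archLocal E 2 J w₁) : GL (Fin 2) ℂ) : Matrix (Fin 2) (Fin 2) ℂ) *ᵥ 𝔣.t₀)) := by
          rw [smul_smul, inv_mul_cancel₀ hw0, one_smul]
      _ = w⁻¹ • 𝔣.t₀ := by rw [h1]
  have hk'v : (((k⁻¹ : archLocal E 2 J w₁) : GL (Fin 2) ℂ) : Matrix (Fin 2) (Fin 2) ℂ) *ᵥ 𝔣.v₀ = 𝔣.v₀ := by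
    conv_lhs => rw [← hkv, mulVec_mulVec, hmul, one_mulVec]
  exact rightRegular_rotation hf hfm hk't hk'v

/-! ## §3 Unitarity bookkeeping -/

omit [CompactSpace (adelicGroupData F E c 2 J).automorphicQuotient] in
/-- `⟪x, R(g) y⟫ = ⟪R(g⁻¹) x, y⟫` (`R` unitary). [cite: BorelJacquet1979, §4.6] -/
theorem inner_rightRegular_right (g : (adelicGroupData F E c 2 J).Adelic) (x y : (adelicGroupData F E c 2 J).L2 μ) :
    ⟪x, (adelicGroupData F E c 2 J).rightRegular μ g y⟫_ℂ = ⟪(adelicGroupData F E c 2 J).rightRegular μ g⁻¹ x, y⟫_ℂ := by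
  conv_rhs => rw [← inner_rightRegular_rightRegular g]
  rw [← mul_apply_eq_comp, ← map_mul, mul_inv_cancel, map_one, one_apply_eq_self]

end Classes

/-! ## §2 The boost absorbs the slice: `Φ_x(s(z)) = ν⁻² f(x · ι u_z)` -/

/-- **The cone extension along the slice.**  For `f ∈ holCotForms₂ … 𝔣`, an adelic `x`, any cone-law extension `Φ` of the slice of `f` at
`x` (clause (H)), the nilpotent `N` of the frame and a boost `u_z` with inverse frame values as in ★ `exists_boost`:
`Φ (1 + z N) = (ν⁻¹ ν⁻¹) f (x · ι u_z)`. [cite: Borel1997, §5.13–§5.14] -/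
theorem apply_slice_eq {f : (adelicGroupData F E c 2 J).Adelic → ℂ} (x : (adelicGroupData F E c 2 J).Adelic)
    {Φ : Matrix (Fin 2) (Fin 2) ℂ → ℂ} (hΦ : IsConeHol 𝔣 Φ)
    (hΦf : ∀ u : archLocal E 2 J w₁, Φ ((u : GL (Fin 2) ℂ) : Matrix (Fin 2) (Fin 2) ℂ) = f (x * adelicSingle F E c 2 J hc hfix w₁ u))
    {N : Matrix (Fin 2) (Fin 2) ℂ} (hNv : N *ᵥ 𝔣.v₀ = 𝔣.t₀) (hNt : N *ᵥ 𝔣.t₀ = 0)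
    {r : ℝ} {z : ℂ} {ν : ℝ} (hr : 0 < r) (hν : 0 < ν) (hν2 : ν ^ 2 * r = r - ‖z‖ ^ 2) {u : archLocal E 2 J w₁}
    (hu't : (((u⁻¹ : archLocal E 2 J w₁) : GL (Fin 2) ℂ) : Matrix (Fin 2) (Fin 2) ℂ) *ᵥ 𝔣.t₀ =
      (ν : ℂ)⁻¹ • 𝔣.t₀ + (-((ν : ℂ)⁻¹ * (starRingEnd ℂ z / r))) • 𝔣.v₀)
    (hu'v : (((u⁻¹ : archLocal E 2 J w₁) : GL (Fin 2) ℂ) : Matrix (Fin 2) (Fin 2) ℂ) *ᵥ 𝔣.v₀ = (-((ν : ℂ)⁻¹ * z)) • 𝔣.t₀ + (ν : ℂ)⁻¹ • 𝔣.v₀) :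
    Φ (1 + z • N) = ((ν : ℂ)⁻¹ * (ν : ℂ)⁻¹) * f (x * adelicSingle F E c 2 J hc hfix w₁ u) := by
  have hν0 : (ν : ℂ) ≠ 0 := Complex.ofReal_ne_zero.2 hν.ne'
  set U : Matrix (Fin 2) (Fin 2) ℂ := ((u : GL (Fin 2) ℂ) : Matrix (Fin 2) (Fin 2) ℂ) with hU
  set U' : Matrix (Fin 2) (Fin 2) ℂ := (((u⁻¹ : archLocal E 2 J w₁) : GL (Fin 2) ℂ) : Matrix (Fin 2) (Fin 2) ℂ) with hU'
  have hUU' : U * U' = 1 := by rw [hU, hU', Subgroup.coe_inv, ← Units.val_mul, mul_inv_cancel, Units.val_one]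
  -- `s(z) = U (U' s(z))`
  have hfac : (1 : Matrix (Fin 2) (Fin 2) ℂ) + z • N = U * (U' * (1 + z • N)) := by rw [← Matrix.mul_assoc, hUU', Matrix.one_mul]
  -- frame coordinates of `b := U' s(z)`
  have hsv : ((1 : Matrix (Fin 2) (Fin 2) ℂ) + z • N) *ᵥ 𝔣.v₀ = 𝔣.v₀ + z • 𝔣.t₀ := by rw [add_mulVec, one_mulVec, smul_mulVec, hNv]
  have hst : ((1 : Matrix (Fin 2) (Fin 2) ℂ) + z • N) *ᵥ 𝔣.t₀ = 𝔣.t₀ := by rw [add_mulVec, one_mulVec, smul_mulVec, hNt, smul_zero, add_zero]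
  have hbv : (U' * (1 + z • N)) *ᵥ 𝔣.v₀ = (ν : ℂ) • 𝔣.v₀ := by
    rw [← mulVec_mulVec, hsv]
    exact inv_boost_mulVec_slice 𝔣 hr hν hν2 hu't hu'v
  have hbt : (U' * (1 + z • N)) *ᵥ 𝔣.t₀ = (ν : ℂ)⁻¹ • 𝔣.t₀ + (-((ν : ℂ)⁻¹ * (starRingEnd ℂ z / r))) • 𝔣.v₀ := by
    rw [← mulVec_mulVec, hst, hu't]
  have hUc := isUnit_and_mulVec_mem_negCone 𝔣 u
  rw [hfac, hΦ.2 U _ _ _ _ hUc.1 hUc.2 hν0 hbv hbt, hU, hΦf u]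


end Summit.HodgeConjecture.HodgeConjecture.Cruxes.HLiu418.E2ArchOrthHolPrep

end
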